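import Mathlib
import Literature.MathematicalPhysics.QuantumFieldTheory.GaugeOSData
import Summits.QuantumFields.YangMills.Theses.DirichletWindow
import Summits.QuantumFields.YangMills.Theorems.ConvexGribovBodyContinuumLegGivenGapStubLock
import HarnessLib

/-!
# `ContinuumLegGivenGap` (stmt-QuantumFields-15828), line `Sketch` (reshape 8): `stub_lock`, part B

Support file for the crux item stmt-QuantumFields-15828 (registered stub `stub_lock`, reshape 8:
under `DirichletWindow.XiDiverges`, from the crux's per-β torus clustering at a compact simple
`(G, r)` produce ONE sequence `β_k → ∞`, rates `m̂_k > 0`, thresholds `S₁ k` and a sharpness factor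
`K > 0` with (UNIFORM) one constant per pair for all `k` and (SHARP) no volume-uniform clustering at
rate `K m̂_k` beyond any threshold). The stub is the open finite-size core and is NOT proved here.
This file reduces it to ONE typed hypothesis and records the `K`-general packaging:

* `stub_lock_of_uniform_of_lower_K` — UNIFORM data, a factor `K > 0`, and at each `β_k` an
  infinite-volume lower bound on the plaquette–plaquette function at a rate `< K m̂_k` ⇒ the
  conclusion of `stub_lock` (the factor-`4` lemma of part A, generalised).
* `exists_admissible_two_mul_sharp` — **per-β two-sidedness is free**: at a coupling where some
  positive rate is admissible (the crux's hypothesis) and rate `1` is not (criticality, from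
  `XiDiverges` via `sharp_eventually_of_xiDiverges`), some admissible rate `M ∈ (0, 1)` has `2M`
  sharp (take `M` above half the supremum of the admissible rates). So ALL the content of
  `stub_lock` is which rates carry `k`-UNIFORM constants.
* `stub_lock_of_twoSidedCoreAlong`, `stub_lock_of_twoSidedCore` (registered sub-goal) — **the
  reduction**: `stub_lock` follows from `XiDiverges`, the crux's hypothesis and the TWO-SIDED
  FINITE-SIZE CORE at `r`:
  `∃ K₀ > 0, β₁, C : YMSpecies G → YMSpecies G → ℝ, ∀ β ≥ β₁, ∀ M ∈ (0, 1], ∀ S₀,`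
  `(rate M admissible at β above S₀ with per-pair constants) →`
  `∃ S₁, ∀ A B, ∀ S ≥ S₁, n ≤ S, |corr_{β,2S+1}(A, B; n)| ≤ C A B · e^{-(M/K₀) n}`,
  i.e. EVERY admissible rate is re-admissible at the fixed fraction `1/K₀` with β-FREE (OS-norm)
  pair constants above a β-dependent volume threshold — verbatim the composite of crux stmt-9443's
  registered stubs `stub_gapFromClustering` (EC at rate `M` ⇒ infinite-volume transfer gap `M`),
  `stub_gapStability` (⇒ `CylGap M/2` on large tori, `M ≤ 1`), `stub_thermalMultiplicity` and
  `stub_blockDecomposition` (⇒ constants `K'(1+K)² ‖A‖∞ ‖B‖∞ e^{t(A)+t(B)}` at rate `M/4`, `K, K'`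
  depending on `r` only), so `K₀ = 4`. Given the core, `β_k := β₁ ∨ β₀ ∨ β₂ + k`, `M_k` from
  `exists_admissible_two_mul_sharp`, `m̂_k := M_k / K₀`, `K := 2 K₀`.
* `one_lt_of_locked` — junk check of the reshaped signature: locked data force `1 < K` (the UNIFORM
  rate is admissible, the SHARP one is not), so the existential factor cannot be met trivially from
  below; from above it cannot rescue sacrificed rates either (SHARP at `K m̂_k` forces every
  admissible rate below `K m̂_k`, `rate_lt_of_sharp`, so `m̂_k ≥ m*(β_k)/K` for a FIXED `K`).

No definitions, no facts; Mathlib + landed tree lemmas only. [folklore]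
-/

noncomputable section

namespace Summit.QuantumFields.YangMills.Theorems.ContinuumLegGivenGap

open Filter Topology
open Literature.MathematicalPhysics.QuantumFieldTheory
open Literature.MathematicalPhysics.QuantumLattice
open Summit.QuantumFields.YangMills.Theses

variable {G : Type} [Group G] [TopologicalSpace G] [IsTopologicalGroup G] [CompactSpace G]
  [MeasurableSpace G] [BorelSpace G]

/-! ### `K`-general packaging -/

/-- **What remains of `stub_lock` (reshape 8), packaged with a general factor.** Given data
satisfying the first three conjuncts (`β_k → ∞`, `m̂_k > 0`, thresholds, `k`-uniform pair constants),
a factor `K > 0`, and at every `β_k` an exponential lower bound on the plaquette–plaquette function of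
every infinite-volume limit state at a rate `< K m̂_k`, the full conclusion of `stub_lock` holds
(`sharp_of_infiniteVolume_lower` at rate `K m̂_k`). [folklore] -/
theorem stub_lock_of_uniform_of_lower_K (r : LatticeRep G) (β : ℕ → ℝ) (mh : ℕ → ℝ) (S₁ : ℕ → ℕ)
    (K : ℝ) (hβ : Tendsto β atTop atTop) (hmh : ∀ k, 0 < mh k) (hK : 0 < K)
    (hunif : ∀ A B : YMSpecies G, ∃ C : ℝ, ∀ k S n : ℕ, S₁ k ≤ S → n ≤ S →
      |latticeConnectedCorr r.ρ (β k) (2 * S + 1) A.F B.F n| ≤ C * Real.exp (-(mh k * n)))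
    (hlow : ∀ k : ℕ, ∀ μ ∈ infiniteVolumeLimitPoints (d := 4) r.ρ (β k), ∃ m A : ℝ, 0 < A ∧
      m < K * mh k ∧ ∀ n : ℕ, A * Real.exp (-(m * n)) ≤
        plaquetteCorrFn r.ρ μ ((n : ℤ) • Pi.single (0 : Fin 4) (1 : ℤ))) :
    ∃ (β : ℕ → ℝ) (mh : ℕ → ℝ) (S₁ : ℕ → ℕ) (K : ℝ), Tendsto β atTop atTop ∧ (∀ k, 0 < mh k) ∧
      0 < K ∧
      (∀ A B : YMSpecies G, ∃ C : ℝ, ∀ k S n : ℕ, S₁ k ≤ S → n ≤ S →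
        |latticeConnectedCorr r.ρ (β k) (2 * S + 1) A.F B.F n| ≤ C * Real.exp (-(mh k * n))) ∧
      (∀ k S₀ : ℕ, ∃ A B : YMSpecies G, ∀ C : ℝ, ∃ S n : ℕ, S₀ ≤ S ∧ n ≤ S ∧
        C * Real.exp (-(K * mh k * n)) < |latticeConnectedCorr r.ρ (β k) (2 * S + 1) A.F B.F n|) :=
  ⟨β, mh, S₁, K, hβ, hmh, hK, hunif, fun k => sharp_of_infiniteVolume_lower r (β k) (K * mh k) (hlow k)⟩

/-- **Junk check of the reshaped signature: locked data force `1 < K`.** If `m̂_k` is admissible at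
`β_k` (UNIFORM, threshold `S₁ k`) while `K m̂_k` is sharp (SHARP), then `m̂_k < K m̂_k`
(`rate_lt_of_sharp`), so `1 < K`: the existential factor of `stub_lock` is never met by `K ≤ 1`.
[folklore] -/
theorem one_lt_of_locked (r : LatticeRep G) (β : ℕ → ℝ) (mh : ℕ → ℝ) (S₁ : ℕ → ℕ) (K : ℝ)
    (hmh : ∀ k, 0 < mh k)
    (hunif : ∀ A B : YMSpecies G, ∃ C : ℝ, ∀ k S n : ℕ, S₁ k ≤ S → n ≤ S →
      |latticeConnectedCorr r.ρ (β k) (2 * S + 1) A.F B.F n| ≤ C * Real.exp (-(mh k * n)))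
    (hsharp : ∀ k S₀ : ℕ, ∃ A B : YMSpecies G, ∀ C : ℝ, ∃ S n : ℕ, S₀ ≤ S ∧ n ≤ S ∧
      C * Real.exp (-(K * mh k * n)) < |latticeConnectedCorr r.ρ (β k) (2 * S + 1) A.F B.F n|) :
    1 < K := by
  have h : mh 0 < K * mh 0 :=
    rate_lt_of_sharp r (β 0) (K * mh 0) (mh 0) (S₁ 0)
      (fun A B => (hunif A B).imp fun C hC S n hS hn => hC 0 S n hS hn) (hsharp 0)
  by_contra hK
  exact absurd h (not_lt.2 (mul_le_of_le_one_left (hmh 0).le (not_lt.1 hK)))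

/-! ### Per-β two-sidedness is free: an admissible rate whose double is sharp -/

/-- **An admissible rate whose double is sharp.** At a coupling `β` where some rate `m > 0` is
admissible (threshold `S₁`, per-pair constants) and rate `1` is NOT admissible beyond any threshold
(the SHARP shape at rate `1`; under `XiDiverges` this holds at all large `β`,
`sharp_eventually_of_xiDiverges`), there is an admissible rate `M ∈ (0, 1)` such that `2M` is sharp.
Proof: the admissible rates form a nonempty set bounded above by `1` (`rate_lt_of_sharp`); take `M`
admissible above half its supremum. So per-β comparability of "the" clustering rate with the best one
carries no content; the content of `stub_lock` is uniformity of the constants in `k`. [folklore] -/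
theorem exists_admissible_two_mul_sharp (r : LatticeRep G) (β : ℝ) {m : ℝ} (hm : 0 < m) (S₁ : ℕ)
    (hclust : ∀ A B : YMSpecies G, ∃ C : ℝ, ∀ S n : ℕ, S₁ ≤ S → n ≤ S →
      |latticeConnectedCorr r.ρ β (2 * S + 1) A.F B.F n| ≤ C * Real.exp (-(m * n)))
    (hsharp : ∀ S₀ : ℕ, ∃ A B : YMSpecies G, ∀ C : ℝ, ∃ S n : ℕ, S₀ ≤ S ∧ n ≤ S ∧
      C * Real.exp (-(1 * n)) < |latticeConnectedCorr r.ρ β (2 * S + 1) A.F B.F n|) :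
    ∃ M : ℝ, 0 < M ∧ M < 1 ∧
      (∃ S₀ : ℕ, ∀ A B : YMSpecies G, ∃ C : ℝ, ∀ S n : ℕ, S₀ ≤ S → n ≤ S →
        |latticeConnectedCorr r.ρ β (2 * S + 1) A.F B.F n| ≤ C * Real.exp (-(M * n))) ∧
      ∀ S₀ : ℕ, ∃ A B : YMSpecies G, ∀ C : ℝ, ∃ S n : ℕ, S₀ ≤ S ∧ n ≤ S ∧
        C * Real.exp (-(2 * M * n)) < |latticeConnectedCorr r.ρ β (2 * S + 1) A.F B.F n| := by
  classical
  set Adm : Set ℝ := {M | ∃ S₀ : ℕ, ∀ A B : YMSpecies G, ∃ C : ℝ, ∀ S n : ℕ, S₀ ≤ S → n ≤ S →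
    |latticeConnectedCorr r.ρ β (2 * S + 1) A.F B.F n| ≤ C * Real.exp (-(M * n))} with hAdm
  have hmem : m ∈ Adm := ⟨S₁, hclust⟩
  have hlt1 : ∀ M ∈ Adm, M < 1 := fun M ⟨S₀, hS₀⟩ => rate_lt_of_sharp r β 1 M S₀ hS₀ hsharp
  have hbdd : BddAbove Adm := ⟨1, fun M hM => (hlt1 M hM).le⟩
  have hne : Adm.Nonempty := ⟨m, hmem⟩
  have hs : 0 < sSup Adm := hm.trans_le (le_csSup hbdd hmem)
  obtain ⟨M, hM, hsM⟩ := exists_lt_of_lt_csSup hne (half_lt_self hs)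
  refine ⟨M, by linarith, hlt1 M hM, hM, fun S₀ => ?_⟩
  by_contra hno
  push Not at hno
  have h2M : 2 * M ≤ sSup Adm := le_csSup hbdd ⟨S₀, hno⟩
  linarith

/-! ### The reduction of `stub_lock` to the two-sided finite-size core -/

/-- **`stub_lock` from the two-sided finite-size core along a sequence.** Under `XiDiverges`, at a
compact simple `(G, r)` with the crux's per-β torus clustering above `β₀`, suppose that along SOME
sequence of couplings `βs k → +∞` every admissible rate `M ∈ (0, 1]` at `βs k` is re-admissible at
rate `M / K₀` (`K₀ > 0` fixed) with INDEX-FREE pair constants `C A B` above an index-dependent volume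
threshold. Then the conclusion of `stub_lock` holds with `K := 2 K₀`: shift the sequence past
`β₀ ∨ β₂` (`β₂` from `sharp_eventually_of_xiDiverges` at rate `1`), pick at each index an admissible
`M_k ∈ (0, 1)` with `2 M_k` sharp (`exists_admissible_two_mul_sharp`), and set `m̂_k := M_k / K₀`.
[folklore] -/
theorem stub_lock_of_twoSidedCoreAlong (hXi : DirichletWindow.XiDiverges)
    (hG : IsCompactSimpleLieGroup G) (r : LatticeRep G) {β₀ : ℝ}
    (hGap : ∀ β : ℝ, β₀ ≤ β → ∃ m : ℝ, 0 < m ∧ ∃ S₁ : ℕ, ∀ A B : YMSpecies G, ∃ C : ℝ,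
      ∀ S n : ℕ, S₁ ≤ S → n ≤ S →
        |latticeConnectedCorr r.ρ β (2 * S + 1) A.F B.F n| ≤ C * Real.exp (-(m * n)))
    (βs : ℕ → ℝ) (hβs : Tendsto βs atTop atTop) {K₀ : ℝ} (hK₀ : 0 < K₀)
    (C : YMSpecies G → YMSpecies G → ℝ)
    (hcore : ∀ (k : ℕ) (M : ℝ) (S₀ : ℕ), 0 < M → M ≤ 1 →
      (∀ A B : YMSpecies G, ∃ C' : ℝ, ∀ S n : ℕ, S₀ ≤ S → n ≤ S →
        |latticeConnectedCorr r.ρ (βs k) (2 * S + 1) A.F B.F n| ≤ C' * Real.exp (-(M * n))) →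
      ∃ S₁ : ℕ, ∀ (A B : YMSpecies G) (S n : ℕ), S₁ ≤ S → n ≤ S →
        |latticeConnectedCorr r.ρ (βs k) (2 * S + 1) A.F B.F n| ≤ C A B * Real.exp (-(M / K₀ * n))) :
    ∃ (β : ℕ → ℝ) (mh : ℕ → ℝ) (S₁ : ℕ → ℕ) (K : ℝ), Tendsto β atTop atTop ∧ (∀ k, 0 < mh k) ∧
      0 < K ∧
      (∀ A B : YMSpecies G, ∃ C : ℝ, ∀ k S n : ℕ, S₁ k ≤ S → n ≤ S →
        |latticeConnectedCorr r.ρ (β k) (2 * S + 1) A.F B.F n| ≤ C * Real.exp (-(mh k * n))) ∧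
      (∀ k S₀ : ℕ, ∃ A B : YMSpecies G, ∀ C : ℝ, ∃ S n : ℕ, S₀ ≤ S ∧ n ≤ S ∧
        C * Real.exp (-(K * mh k * n)) < |latticeConnectedCorr r.ρ (β k) (2 * S + 1) A.F B.F n|) := by
  obtain ⟨β₂, hβ₂⟩ := sharp_eventually_of_xiDiverges hXi hG r 1 one_pos
  obtain ⟨N, hN⟩ := eventually_atTop.1 (hβs.eventually (eventually_ge_atTop (max β₀ β₂)))
  have hsel : ∀ k : ℕ, ∃ M : ℝ, 0 < M ∧ M < 1 ∧
      (∃ S₀ : ℕ, ∀ A B : YMSpecies G, ∃ C' : ℝ, ∀ S n : ℕ, S₀ ≤ S → n ≤ S →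
        |latticeConnectedCorr r.ρ (βs (k + N)) (2 * S + 1) A.F B.F n| ≤ C' * Real.exp (-(M * n))) ∧
      ∀ S₀ : ℕ, ∃ A B : YMSpecies G, ∀ C' : ℝ, ∃ S n : ℕ, S₀ ≤ S ∧ n ≤ S ∧
        C' * Real.exp (-(2 * M * n)) <
          |latticeConnectedCorr r.ρ (βs (k + N)) (2 * S + 1) A.F B.F n| := fun k => by
    have hk : max β₀ β₂ ≤ βs (k + N) := hN (k + N) (Nat.le_add_left N k)
    obtain ⟨m, hm, S₁, hS₁⟩ := hGap (βs (k + N)) ((le_max_left _ _).trans hk)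
    exact exists_admissible_two_mul_sharp r (βs (k + N)) hm S₁ hS₁
      (hβ₂ _ ((le_max_right _ _).trans hk))
  choose M hM0 hM1 hMadm hMsharp using hsel
  have hS : ∀ k : ℕ, ∃ S₁ : ℕ, ∀ (A B : YMSpecies G) (S n : ℕ), S₁ ≤ S → n ≤ S →
      |latticeConnectedCorr r.ρ (βs (k + N)) (2 * S + 1) A.F B.F n| ≤
        C A B * Real.exp (-(M k / K₀ * n)) := fun k => by
    obtain ⟨S₀, hS₀⟩ := hMadm k
    exact hcore (k + N) (M k) S₀ (hM0 k) (hM1 k).le hS₀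
  choose S₁ hS₁ using hS
  refine ⟨fun k => βs (k + N), fun k => M k / K₀, S₁, 2 * K₀, hβs.comp (tendsto_add_atTop_nat N),
    fun k => div_pos (hM0 k) hK₀, by positivity,
    fun A B => ⟨C A B, fun k S n hS hn => hS₁ k A B S n hS hn⟩, fun k S₀ => ?_⟩
  have h : 2 * K₀ * (M k / K₀) = 2 * M k := by
    field_simp
  rw [h]
  exact hMsharp k S₀

/-- **`stub_lock_of_twoSidedCore`** (registered sub-goal of stmt-QuantumFields-15828, line `Sketch`):
the reshaped `stub_lock` REDUCED to the two-sided finite-size core at `r` — `∃ K₀ > 0, β₁` and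
β-FREE pair constants `C A B` such that at every `β ≥ β₁` every rate `M ∈ (0, 1]` admissible on the
tori (threshold, per-pair constants) is re-admissible at rate `M / K₀` with the constants `C A B`
above a β-dependent threshold (crux stmt-9443's `stub_gapFromClustering` ∘ `stub_gapStability` ∘
`stub_thermalMultiplicity` ∘ `stub_blockDecomposition`, `K₀ = 4`,
`C A B = K'(1+K)² ‖A‖∞ ‖B‖∞ e^{t(A)+t(B)}`). With `XiDiverges` (rate `1` eventually sharp) and the
crux's hypothesis (a positive admissible rate) this yields `stub_lock`'s sequence `β₁ + k` (shifted),
rates `m̂_k = M_k / K₀` with `M_k` admissible and `2 M_k` sharp, the core's thresholds, and the factor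
`K = 2 K₀` (`stub_lock_of_twoSidedCoreAlong`). [folklore] -/
theorem stub_lock_of_twoSidedCore :
    DirichletWindow.XiDiverges →
    ∀ (G : Type) [Group G] [TopologicalSpace G] [IsTopologicalGroup G] [CompactSpace G]
      [MeasurableSpace G] [BorelSpace G], IsCompactSimpleLieGroup G → ∀ r : LatticeRep G,
      (∃ β₀ : ℝ, ∀ β : ℝ, β₀ ≤ β → ∃ m : ℝ, 0 < m ∧ ∃ S₁ : ℕ, ∀ A B : YMSpecies G, ∃ C : ℝ,
        ∀ S n : ℕ, S₁ ≤ S → n ≤ S →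
          |latticeConnectedCorr r.ρ β (2 * S + 1) A.F B.F n| ≤ C * Real.exp (-(m * n))) →
      (∃ (K₀ β₁ : ℝ) (C : YMSpecies G → YMSpecies G → ℝ), 0 < K₀ ∧
        ∀ (β M : ℝ) (S₀ : ℕ), β₁ ≤ β → 0 < M → M ≤ 1 →
          (∀ A B : YMSpecies G, ∃ C' : ℝ, ∀ S n : ℕ, S₀ ≤ S → n ≤ S →
            |latticeConnectedCorr r.ρ β (2 * S + 1) A.F B.F n| ≤ C' * Real.exp (-(M * n))) →
          ∃ S₁ : ℕ, ∀ (A B : YMSpecies G) (S n : ℕ), S₁ ≤ S → n ≤ S →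
            |latticeConnectedCorr r.ρ β (2 * S + 1) A.F B.F n| ≤ C A B * Real.exp (-(M / K₀ * n))) →
      ∃ (β : ℕ → ℝ) (mh : ℕ → ℝ) (S₁ : ℕ → ℕ) (K : ℝ), Tendsto β atTop atTop ∧ (∀ k, 0 < mh k) ∧
        0 < K ∧
        (∀ A B : YMSpecies G, ∃ C : ℝ, ∀ k S n : ℕ, S₁ k ≤ S → n ≤ S →
          |latticeConnectedCorr r.ρ (β k) (2 * S + 1) A.F B.F n| ≤ C * Real.exp (-(mh k * n))) ∧
        (∀ k S₀ : ℕ, ∃ A B : YMSpecies G, ∀ C : ℝ, ∃ S n : ℕ, S₀ ≤ S ∧ n ≤ S ∧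
          C * Real.exp (-(K * mh k * n)) <
            |latticeConnectedCorr r.ρ (β k) (2 * S + 1) A.F B.F n|) := by
  intro hXi G _ _ _ _ _ _ hG r hGap hcore
  obtain ⟨β₀, hGap⟩ := hGap
  obtain ⟨K₀, β₁, C, hK₀, hcore⟩ := hcore
  exact stub_lock_of_twoSidedCoreAlong hXi hG r hGap (fun k => β₁ + k)
    (tendsto_atTop_add_const_left _ _ tendsto_natCast_atTop_atTop) hK₀ C
    fun k M S₀ hM hM1 hadm => hcore (β₁ + k) M S₀ (by simp) hM hM1 hadm

end Summit.QuantumFields.YangMills.Theorems.ContinuumLegGivenGap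

end
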